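import Literature.Probability.LatticeModels.IsingDisorderObservable
import HarnessLib

/-!
# The seam of the signed Kadanoff–Ceva observable: opposite projections at the cut corners

Topic `Literature/Probability/LatticeModels`; a complement to `IsingDisorderObservable.lean`
(Chelkak–Hongler–Izyurov 2015, Prop. 2.4 and §3.2; Chelkak–Hongler–Izyurov 2021, Lemma 2.12). There
the signed critical Kadanoff–Ceva observable `kcObs` is shown to be s-holomorphic (`IsSHolAt`) at
the lower corners `(y, SW)`, `(y, SE)` whenever the two sign conventions agree
(`hLowSign = vLowSign`), and its docstring states that "where they disagree the projections are
opposite: this is the sheet change of the spinor along the seam emanating from the source corner".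
This file proves that statement: at a lower corner where `hLowSign = -vLowSign` the projections of
the two adjacent bond values onto the corner line are OPPOSITE (`projLine_kcObs_SW_seam`,
`projLine_kcObs_SE_seam`), in frame form `(frameCoord · (1+i)^k).re = -(…)` as well. Along the seam
the observable is therefore a section of a genuine spinor (multiplicative monodromy `-1` around the
source, CHI15 Prop. 2.4), and `|Proj|²`-increments of the primitive `H` (`cornerFlux` of
`SHolomorphicPrimitive.lean`) do not see the seam. Everything is proved; no named fact.

## References

* D. Chelkak, C. Hongler, K. Izyurov, Ann. of Math. 181 (2015) = arXiv:1202.2838: Prop. 2.4,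
  §3.2 [ChelkakHonglerIzyurovAnnals2015].
* D. Chelkak, C. Hongler, K. Izyurov, arXiv:2103.10263 (2021): Lemma 2.12, Remark 2.11
  [ChelkakHonglerIzyurov2021].
-/

noncomputable section

namespace Literature.Probability.LatticeModels

open Complex ComplexConjugate SimpleGraph

/-- Projection onto a line is odd in the projected vector: `Proj[-X ; η] = -Proj[X ; η]`
(`projLine_neg` of `FermionicObservableSums.lean` is the statement in `η`). [folklore] -/
theorem projLine_neg_right (η X : ℂ) : projLine η (-X) = -projLine η X := by
  rw [projLine_eq, projLine_eq, ← neg_smul]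
  congr 1
  rw [neg_mul, Complex.neg_re, neg_div]

/-- The frame coordinate is odd. [folklore] -/
theorem frameCoord_neg (v₀ : Site 2) (X : ℂ) : frameCoord v₀ (-X) = -frameCoord v₀ X := by
  rw [frameCoord, frameCoord, neg_mul]

/-- Opposite projections onto a corner line, in frame form. [folklore] -/
theorem projLine_cornerLine_eq_neg_iff (v₀ v : Site 2) (k : Fin 4) {n : ℕ} (hn : n % 4 = (k : ℕ)) (X Y : ℂ) :
    projLine (cornerLine v (faceAt v k)) X = -projLine (cornerLine v (faceAt v k)) Y ↔
      (frameCoord v₀ X * (1 + I) ^ n).re = -(frameCoord v₀ Y * (1 + I) ^ n).re := by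
  rw [← projLine_neg_right, projLine_cornerLine_eq_iff v₀ v k hn, frameCoord_neg, neg_mul, Complex.neg_re]

section Seam

variable (G₂ : SimpleGraph (Site 2)) [G₂.LocallyFinite]
variable {Λ : Finset (Site 2)} {η : SpinConfig (Site 2)} {B : Finset (Site 2)} {cut : Site 2 → Finset (Sym2 (Site 2))}

/-- **The seam at a corner `(y, SW)`**: if the two sign conventions DISAGREE at this corner
(`hLowSign (y - e₀) = -vLowSign (y - e₁)`), the projections of the observable on the west bond and on
the south bond onto the line of the corner `(y, 2)` are opposite. (Same computation as
`projLine_kcObs_SW`, with the sign flipped.) [cite: ChelkakHonglerIzyurovAnnals2015, Prop. 2.4 and §3.2 (the sheet change along the cut)] -/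
theorem projLine_kcObs_SW_seam (hG : ∀ v ∈ Λ, ∀ k : Fin 4, G₂.Adj v (v + cornerUnit k)) (hle : G₂ ≤ zdGraph 2)
    {y : Site 2} (hT : cut (faceAt y 2) ⊆ edgesTouching G₂ Λ)
    (he : s(y + cornerUnit 3, y + cornerUnit 3 + cornerUnit 1) ∈ edgesTouching G₂ Λ)
    (hstep : KCGaugeEquiv G₂ Λ (symmDiff (cut (faceAt y 2)) {s(y + cornerUnit 3, y + cornerUnit 3 + cornerUnit 1)})
      (cut (faceAt y 3)))
    (hsign : hLowSign B (y + cornerUnit 2) = -vLowSign B cut (y + cornerUnit 3)) :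
    projLine (cornerLine y (faceAt y 2)) (kcObsH G₂ Λ η B cut (y + cornerUnit 2)) =
      -projLine (cornerLine y (faceAt y 2)) (kcObsV G₂ Λ η B cut (y + cornerUnit 3)) := by
  obtain ⟨w0, wf0, wf3, wy1⟩ := westSite_facts y
  obtain ⟨s0, sf1, sf0, sy1⟩ := southSite_facts y
  rw [projLine_cornerLine_eq_neg_iff 0 y 2 (n := 2) (by norm_num), kcObsH, kcObsV, (re_frameCoord_kcVecH 0 _ _).2.1,
    (re_frameCoord_kcVecV 0 _ _).2.1, wf3, w0, sf1, sf0, s0, sy1, frameNorm_succ, hsign, vLowSign, sf1]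
  have hsub := symmDiff_singleton_subset_edgesTouching G₂ hT he
  have e1 : kcS G₂ Λ criticalBetaTwo (.fixed η) B (cut (faceAt y 3)) (y + cornerUnit 3 + cornerUnit 1) =
      Real.sqrt 2 * kcS G₂ Λ criticalBetaTwo (.fixed η) B (cut (faceAt y 2)) (y + cornerUnit 3 + cornerUnit 1) -
        vToggleSign (cut (faceAt y 2)) (y + cornerUnit 3) * kcS G₂ Λ criticalBetaTwo (.fixed η) B (cut (faceAt y 2)) (y + cornerUnit 3) := by
    rw [hstep.kcS_eq G₂ hG hle hsub, kcS_toggle_vertical_top]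
  rw [s0] at e1
  rw [e1, sy1]
  have hκ := vToggleSign_mul_self (cut (faceAt y 2)) (y + cornerUnit 3)
  have hs : Real.sqrt 2 ^ 2 = 2 := Real.sq_sqrt zero_le_two
  linear_combination (-(rowSign B (y 1 - 1) * kcS G₂ Λ criticalBetaTwo (.fixed η) B (cut (faceAt y 2)) (y + cornerUnit 3) *
    (Real.sqrt 2 * frameNorm 0 0))) * hκ +
    (vToggleSign (cut (faceAt y 2)) (y + cornerUnit 3) * rowSign B (y 1 - 1) *
      kcS G₂ Λ criticalBetaTwo (.fixed η) B (cut (faceAt y 2)) y * frameNorm 0 0) * hs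

/-- **The seam at a corner `(y, SE)`**: if `vLowSign (y - e₁) = -hLowSign y`, the projections of the
observable on the south bond and on the east bond onto the line of the corner `(y, 3)` are opposite. [cite: ChelkakHonglerIzyurovAnnals2015, Prop. 2.4 and §3.2 (the sheet change along the cut)] -/
theorem projLine_kcObs_SE_seam (hG : ∀ v ∈ Λ, ∀ k : Fin 4, G₂.Adj v (v + cornerUnit k)) (hle : G₂ ≤ zdGraph 2)
    {y : Site 2} (hT : cut (faceAt y 0) ⊆ edgesTouching G₂ Λ)
    (he : s(y, y + cornerUnit 0) ∈ edgesTouching G₂ Λ)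
    (hstep : KCGaugeEquiv G₂ Λ (symmDiff (cut (faceAt y 0)) {s(y, y + cornerUnit 0)}) (cut (faceAt y 3)))
    (hsign : vLowSign B cut (y + cornerUnit 3) = -hLowSign B y) :
    projLine (cornerLine y (faceAt y 3)) (kcObsV G₂ Λ η B cut (y + cornerUnit 3)) =
      -projLine (cornerLine y (faceAt y 3)) (kcObsH G₂ Λ η B cut y) := by
  obtain ⟨s0, sf1, sf0, sy1⟩ := southSite_facts y
  rw [projLine_cornerLine_eq_neg_iff 0 y 3 (n := 3) (by norm_num), kcObsH, kcObsV, (re_frameCoord_kcVecV 0 _ _).2.2.1,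
    (re_frameCoord_kcVecH 0 _ _).2.2, sf0, s0, frameNorm_succ, hsign, hLowSign]
  have hsub := symmDiff_singleton_subset_edgesTouching G₂ hT he
  have e1 : kcS G₂ Λ criticalBetaTwo (.fixed η) B (cut (faceAt y 3)) y =
      (-1) ^ rayCountB B s(y, y + cornerUnit 0) *
        (Real.sqrt 2 * kcS G₂ Λ criticalBetaTwo (.fixed η) B (cut (faceAt y 0)) y -
          kcS G₂ Λ criticalBetaTwo (.fixed η) B (cut (faceAt y 0)) (y + cornerUnit 0)) := by
    rw [hstep.kcS_eq G₂ hG hle hsub, kcS_toggle_horizontal_left]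
  have e2 : kcS G₂ Λ criticalBetaTwo (.fixed η) B (cut (faceAt y 3)) (y + cornerUnit 0) =
      -(-1) ^ rayCountB B s(y, y + cornerUnit 0) *
        (Real.sqrt 2 * kcS G₂ Λ criticalBetaTwo (.fixed η) B (cut (faceAt y 0)) (y + cornerUnit 0) -
          kcS G₂ Λ criticalBetaTwo (.fixed η) B (cut (faceAt y 0)) y) := by
    rw [hstep.kcS_eq G₂ hG hle hsub, kcS_toggle_horizontal_right]
  rw [e1, e2]
  have hρ := neg_one_pow_mul_self' (rayCountB B s(y, y + cornerUnit 0))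
  have hs : Real.sqrt 2 ^ 2 = 2 := Real.sq_sqrt zero_le_two
  linear_combination
    (2 * rowSign B (y 1) * frameNorm 0 0 * kcS G₂ Λ criticalBetaTwo (.fixed η) B (cut (faceAt y 0)) y) * hρ +
    (2 * rowSign B (y 1) * frameNorm 0 0 * kcS G₂ Λ criticalBetaTwo (.fixed η) B (cut (faceAt y 0)) y *
      ((-1) ^ rayCountB B s(y, y + cornerUnit 0) * (-1) ^ rayCountB B s(y, y + cornerUnit 0))) * hs

end Seam

end Literature.Probability.LatticeModels
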